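import Mathlib
import Summits.NavierStokesRegularity.NavierStokesRegularity.Theorems.FilamentSkeletonRssStadiumPartnerReal

/-!
# The stub's OWN-filament real Biot–Savart integrand is integrable, and the complexified own kernel agrees with it on the real trace
# (`TangentSkeletonNearStraightL`, stmt-NavierStokesRegularity-23320, registered stub `stub_stripPropagation`, the `k = j` summand)

For a `C¹` unit-speed near-straight curve `X` (tangent oscillation `≤ 1/2`, so the chord is `≥ (7/8)|σ − t|`,
Theorems.NearStraightEscape.chord_ge_seven_eighths) with continuous core `A ≥ Λ⁻¹ > 0` and `κ > 0`, the own summand of `u X (X j t)`,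
`σ ↦ ((‖X t − X σ‖² + κA σ)^{3/2})⁻¹ • cross (X′ σ) (X t − X σ)`, is Bochner-integrable on `ℝ` (`integrable_own_real_kernel`): the matched core removes
the diagonal singularity (`d/(d² + m)^{3/2} ≤ (d² + m)⁻¹`, `m = κ/Λ`) and the chord gives the Lorentzian tail `((7/8)²(σ − t)² + m)⁻¹`
(Theorems.StadiumFarMajorant.integrable_lorentzian).  Consequently (`own_real_setIntegral_eq`) on any measurable source set `T` the complexified own
kernel at a real target `t`, with real sources, integrates to the coordinatewise complexification of the real set integral
(Theorems.StadiumPartnerReal.kernel_real + `ContinuousLinearMap.integral_comp_comm`) — the real-trace clause of `StadiumAnalyticBdd` for the own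
filament, whose height-`0` contour is the real axis.  HONEST FRAMING: a tool for a HYPOTHETICAL filament skeleton on the NEGATIVE side of a MODEL
route; nothing here bears on Navier–Stokes regularity or blow-up.  `--supports stmt-NavierStokesRegularity-23320`.
-/

set_option linter.dupNamespace false

noncomputable section

namespace Summit.NavierStokesRegularity.NavierStokesRegularity.Theorems.StadiumOwnReal

open Set Metric MeasureTheory
open scoped InnerProductSpace Matrix
open Literature.Analysis.FluidPDE
open Summit.NavierStokesRegularity.NavierStokesRegularity.Theorems.StadiumFarMajorant
open Summit.NavierStokesRegularity.NavierStokesRegularity.Theorems.NearStraightEscape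
open Summit.NavierStokesRegularity.NavierStokesRegularity.Theorems.StadiumPartnerReal

/-- `d/r^{3/2} ≤ 1/r` when `d² ≤ r`, `0 < r`. [folklore] -/
theorem div_rpow_threeHalves_le {r d : ℝ} (hr : 0 < r) (hd : 0 ≤ d) (hdr : d ^ 2 ≤ r) : d / r ^ (3/2 : ℝ) ≤ 1 / r := by
  have hsq : d ≤ r ^ (1/2 : ℝ) := by
    have : d = (d ^ 2) ^ (1/2 : ℝ) := by
      rw [← Real.sqrt_eq_rpow, Real.sqrt_sq hd]
    rw [this]
    exact Real.rpow_le_rpow (sq_nonneg _) hdr (by norm_num)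
  have hsplit : r ^ (3/2 : ℝ) = r * r ^ (1/2 : ℝ) := by
    rw [show (3/2 : ℝ) = 1 + 1/2 by norm_num, Real.rpow_add hr, Real.rpow_one]
  rw [hsplit, div_le_div_iff₀ (by positivity) hr]
  calc d * r ≤ r ^ (1/2 : ℝ) * r := mul_le_mul_of_nonneg_right hsq hr.le
    _ = 1 * (r * r ^ (1/2 : ℝ)) := by ring

/-- **Integrability of the own-filament real integrand.**  See the module docstring. [folklore] -/
theorem integrable_own_real_kernel {X : ℝ → EuclideanSpace ℝ (Fin 3)} (hX : ContDiff ℝ 1 X) (hXu : ∀ σ, ‖deriv X σ‖ = 1)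
    (hosc : ∀ τ σ, ‖deriv X τ - deriv X σ‖ ≤ 1 / 2) {A : ℝ → ℝ} (hAc : Continuous A) {Λ κ : ℝ} (hΛ : 0 < Λ)
    (hA : ∀ σ, Λ⁻¹ ≤ A σ) (hκ : 0 < κ) (t : ℝ) :
    Integrable fun σ : ℝ => ((‖X t - X σ‖ ^ 2 + κ * A σ) ^ (3/2 : ℝ))⁻¹ • cross (deriv X σ) (X t - X σ) := by
  have hXc : Continuous X := hX.continuous
  have hdXc : Continuous (deriv X) := hX.continuous_deriv le_rfl
  have hXd : Differentiable ℝ X := hX.differentiable (by simp)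
  set m : ℝ := κ / Λ with hm
  have hm0 : 0 < m := by positivity
  have hAm : ∀ σ, m ≤ κ * A σ := by
    intro σ
    have h := mul_le_mul_of_nonneg_left (hA σ) hκ.le
    calc m = κ * Λ⁻¹ := by rw [hm, div_eq_mul_inv]
      _ ≤ κ * A σ := h
  have hbase_pos : ∀ σ, 0 < ‖X t - X σ‖ ^ 2 + κ * A σ := by
    intro σ
    have h1 : 0 < κ * A σ := lt_of_lt_of_le hm0 (hAm σ)
    positivity
  -- continuity
  have hcont : Continuous fun σ : ℝ => ((‖X t - X σ‖ ^ 2 + κ * A σ) ^ (3/2 : ℝ))⁻¹ • cross (deriv X σ) (X t - X σ) := by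
    have hb : Continuous fun σ : ℝ => ‖X t - X σ‖ ^ 2 + κ * A σ :=
      ((continuous_const.sub hXc).norm.pow 2).add (continuous_const.mul hAc)
    have hp : Continuous fun σ : ℝ => (‖X t - X σ‖ ^ 2 + κ * A σ) ^ (3/2 : ℝ) :=
      hb.rpow_const fun σ => Or.inr (by norm_num)
    have hi : Continuous fun σ : ℝ => ((‖X t - X σ‖ ^ 2 + κ * A σ) ^ (3/2 : ℝ))⁻¹ :=
      hp.inv₀ fun σ => (Real.rpow_pos_of_pos (hbase_pos σ) _).ne'
    have hc : Continuous fun σ : ℝ => cross (deriv X σ) (X t - X σ) := by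
      have hsub : Continuous fun σ : ℝ => X t - X σ := continuous_const.sub hXc
      have h : Continuous ((Function.uncurry fun x y => crossCLM x y) ∘ fun σ => (deriv X σ, X t - X σ)) :=
        crossCLM.continuous₂.comp (hdXc.prodMk hsub)
      exact h
    exact hi.smul hc
  -- the majorant `((7/8)²(σ − t)² + m)⁻¹`
  set a : ℝ := Real.sqrt m with ha
  have ha0 : 0 < a := Real.sqrt_pos.2 hm0
  have ha2 : a ^ 2 = m := Real.sq_sqrt hm0.le
  have hmaj : ∀ σ, ‖((‖X t - X σ‖ ^ 2 + κ * A σ) ^ (3/2 : ℝ))⁻¹ • cross (deriv X σ) (X t - X σ)‖ ≤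
      ((7 / 8) ^ 2 * (σ - t) ^ 2 + a ^ 2)⁻¹ := by
    intro σ
    set d : ℝ := ‖X t - X σ‖ with hd
    set r : ℝ := d ^ 2 + κ * A σ with hr
    have hrpos : 0 < r := hbase_pos σ
    have hcross : ‖cross (deriv X σ) (X t - X σ)‖ ≤ d := by
      rw [norm_cross, hXu σ, one_mul]
      have h := Real.sin_le_one (InnerProductGeometry.angle (deriv X σ) (X t - X σ))
      have h0 : 0 ≤ ‖X t - X σ‖ := norm_nonneg _
      simp only [hd]
      nlinarith
    have hpow : 0 < r ^ (3/2 : ℝ) := Real.rpow_pos_of_pos hrpos _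
    have h1 : ‖((‖X t - X σ‖ ^ 2 + κ * A σ) ^ (3/2 : ℝ))⁻¹ • cross (deriv X σ) (X t - X σ)‖ ≤ d / r ^ (3/2 : ℝ) := by
      rw [norm_smul, norm_inv, Real.norm_eq_abs, abs_of_pos hpow, le_div_iff₀ hpow]
      have e : (r ^ (3/2 : ℝ))⁻¹ * ‖cross (deriv X σ) (X t - X σ)‖ * r ^ (3/2 : ℝ) = ‖cross (deriv X σ) (X t - X σ)‖ := by
        field_simp
      rw [e]
      exact hcross
    have h2 : d / r ^ (3/2 : ℝ) ≤ 1 / r := div_rpow_threeHalves_le hrpos (norm_nonneg _) (by simp only [hr]; linarith [hAm σ, hm0])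
    have hchord : 7 / 8 * |σ - t| ≤ d := by
      have h := chord_ge_seven_eighths hXd hXu hosc le_rfl t σ
      rwa [norm_sub_rev] at h
    have h3 : (7 / 8) ^ 2 * (σ - t) ^ 2 + a ^ 2 ≤ r := by
      rw [ha2]
      have hsq : ((7 / 8) * |σ - t|) ^ 2 ≤ d ^ 2 := pow_le_pow_left₀ (by positivity) hchord 2
      rw [mul_pow, sq_abs] at hsq
      simp only [hr]
      linarith [hAm σ]
    have hl0 : 0 < (7 / 8) ^ 2 * (σ - t) ^ 2 + a ^ 2 := by positivity
    calc _ ≤ d / r ^ (3/2 : ℝ) := h1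
      _ ≤ 1 / r := h2
      _ ≤ ((7 / 8) ^ 2 * (σ - t) ^ 2 + a ^ 2)⁻¹ := by
          rw [one_div]; exact inv_anti₀ hl0 h3
  have hint : Integrable (fun σ : ℝ => ((7 / 8) ^ 2 * (σ - t) ^ 2 + a ^ 2)⁻¹) :=
    integrable_lorentzian ha0 (by norm_num : (7 / 8 : ℝ) ≠ 0) t
  exact hint.mono' hcont.aestronglyMeasurable (Filter.Eventually.of_forall hmaj)

/-- **Real agreement for the own filament on a measurable source set.**  At a real target `t` of the trace (`F t = cplx (X t)`) and for real
sources (`F σ` replaced by `X σ` — the height-`0` contour), the complexified own kernel integrates over any measurable `T ⊆ ℝ` to the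
coordinatewise complexification of the stub's real set integral. [folklore] -/
theorem own_real_setIntegral_eq {hs L cc κ Λ : ℝ} {F : ℂ → (Fin 3 → ℂ)} {X : ℝ → EuclideanSpace ℝ (Fin 3)}
    (hFX : ∀ r : ℝ, (r : ℂ) ∈ {z : ℂ | |z.im| < hs ∧ |z.re - cc| < L + hs} →
      F r = fun i => ((⟪X r, EuclideanSpace.single i (1:ℝ)⟫_ℝ : ℝ) : ℂ))
    (hX : ContDiff ℝ 1 X) (hXu : ∀ σ, ‖deriv X σ‖ = 1) (hosc : ∀ τ σ, ‖deriv X τ - deriv X σ‖ ≤ 1 / 2)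
    {A : ℝ → ℝ} (hAc : Continuous A) (hΛ : 0 < Λ) (hA : ∀ σ, Λ⁻¹ ≤ A σ) (hκ : 0 < κ)
    (hhs : 0 < hs) {t : ℝ} (ht : |t - cc| < L + hs) (T : Set ℝ) :
    (∫ σ in T, (((∑ i, (F t i - ((X σ i : ℝ) : ℂ)) ^ 2) + ((κ * A σ : ℝ) : ℂ)) ^ ((3:ℂ) / 2))⁻¹ •
        ((fun i => ((deriv X σ i : ℝ) : ℂ)) ⨯₃ (fun i => F t i - ((X σ i : ℝ) : ℂ)))) =
      fun i => (((∫ σ in T, ((‖X t - X σ‖ ^ 2 + κ * A σ) ^ (3/2 : ℝ))⁻¹ • cross (deriv X σ) (X t - X σ)) i : ℝ) : ℂ) := by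
  set Lc : EuclideanSpace ℝ (Fin 3) →L[ℝ] (Fin 3 → ℂ) :=
    ContinuousLinearMap.pi fun i => Complex.ofRealCLM.comp (EuclideanSpace.proj i) with hLc
  have hLc_apply : ∀ v : EuclideanSpace ℝ (Fin 3), Lc v = fun i => ((v i : ℝ) : ℂ) := by
    intro v; funext i; simp [hLc]
  have htS : ((t : ℝ) : ℂ) ∈ {z : ℂ | |z.im| < hs ∧ |z.re - cc| < L + hs} := ⟨by simpa using hhs, by simpa using ht⟩
  have hFt : ∀ i, F t i = ((X t i : ℝ) : ℂ) := by
    intro i; rw [hFX t htS]; simp only [StadiumDeviationPackage.inner_single_eq]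
  have hA0 : ∀ σ, 0 ≤ A σ := fun σ => le_trans (by positivity) (hA σ)
  have hpt : ∀ σ, (((∑ i, (F t i - ((X σ i : ℝ) : ℂ)) ^ 2) + ((κ * A σ : ℝ) : ℂ)) ^ ((3:ℂ) / 2))⁻¹ •
        ((fun i => ((deriv X σ i : ℝ) : ℂ)) ⨯₃ (fun i => F t i - ((X σ i : ℝ) : ℂ))) =
      Lc (((‖X t - X σ‖ ^ 2 + κ * A σ) ^ (3/2 : ℝ))⁻¹ • cross (deriv X σ) (X t - X σ)) := by
    intro σ
    have h := kernel_real (X t) X hκ.le hA0 σ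
    simp only [← hFt] at h
    rw [hLc_apply]
    exact h
  simp_rw [hpt]
  have hint := (integrable_own_real_kernel hX hXu hosc hAc hΛ hA hκ t).integrableOn (s := T)
  rw [Lc.integral_comp_comm hint, hLc_apply]

end Summit.NavierStokesRegularity.NavierStokesRegularity.Theorems.StadiumOwnReal

end
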